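import Mathlib
import Summits.Ventures.PercRepro2.CrossAPrimeInduction
import Summits.Ventures.PercRepro2.BHKEvents
import Summits.Ventures.PercRepro2.RBRootEdge

/-!
# The `a₂`-side route for the sign of `crossA′so`, I: the constant-`π` functional `crossC`
(blind cell PercRepro2, p5 g34; S4 §2.4 (s) addendum 27 (4); continued in `CrossAPrimeA2Induction`)

Replace the factor `π = P(a₁ ↔ v)` of `crossA′so` by a CONSTANT `c`:
`crossC p c = 2Z·Dv − y·xv − x·yv + c·x·y` (**`crossA'so_eq_crossC`**: `crossA′so = crossC p π`;
`crossC` is monotone in `c`, **`crossA'so_nonneg_of_crossC`**).  With `c` constant every mass is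
affine in each edge weight and `crossC` is a sum of products of two masses, so along EVERY edge it
is a QUADRATIC (**`crossC_pin_quadratic`**): `(1 − q)²·B₀ + q(1 − q)·(Φ₀₁ + Φ₁₀) + q²·B₃` with
`Φ_{εη} = crossPatC` on the pinned measures; the edge `{a₂, a₁}` is free (`crossPatC_update_one_eq_zero`).  The tools of the
induction on the random edges at the sure cluster of `a₂`: the masses only see the support
(`crossC_congr_supp`), so `a₂` may be re-rooted inside its sure cluster (**`crossC_reroot`**); a
random loop is free (`crossC_update_loop`); and the deterministic base case
(**`crossC_nonneg_of_det`**: `K = S` surely and `crossC = c·[a₁ ∉ S]·[o ∈ S]·[b ∈ S] ≥ 0`).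
Own work; standard axioms.
-/

namespace Summit.Ventures.PercRepro2

open LeafRowPendantRootSO CrossAPrimeA1VMid CrossAPrimeSupport CrossAPrimeRootEdge
  CrossAPrimeInduction

namespace CrossAPrimeA2Route

section Defs

variable {V : Type*} {E : Type*} [Fintype E] [DecidableEq E] {R : Type*} [Field R]
variable {ends : E → Sym2 V}

/-- **The constant-`π` functional** `crossC p c = 2Z·Dv − y·xv − x·yv + c·x·y`
(`Z = P(Q)`, `x = P(Q, oH)`, `y = P(Q, bH)`, `xv = P(Q, vL, oH)`, `yv = P(Q, vL, bH)`,
`Dv = P(Q, vL, oH, bH)`; `Q = {a₂ ↮ a₁}`). -/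
noncomputable def crossC (p : E → R) (c : R) (ends : E → Sym2 V) (o a₁ a₂ v b : V) : R :=
  2 * prob p (avoidAll ends a₂ {a₁}) *
      prob p (avoidAll ends a₂ {a₁} ∩ (connEvent ends a₁ v ∩ (connEvent ends a₂ o ∩ connEvent ends a₂ b))) -
    prob p (avoidAll ends a₂ {a₁} ∩ connEvent ends a₂ b) *
      prob p (avoidAll ends a₂ {a₁} ∩ (connEvent ends a₁ v ∩ connEvent ends a₂ o)) +
    c * prob p (avoidAll ends a₂ {a₁} ∩ connEvent ends a₂ o) *
      prob p (avoidAll ends a₂ {a₁} ∩ connEvent ends a₂ b) -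
    prob p (avoidAll ends a₂ {a₁} ∩ connEvent ends a₂ o) *
      prob p (avoidAll ends a₂ {a₁} ∩ (connEvent ends a₁ v ∩ connEvent ends a₂ b))

/-- The two-copy pattern with a constant: `Q`-masses from `pa`, `v`-masses from `pb`. -/
noncomputable def crossPatC (pa pb : E → R) (c : R) (ends : E → Sym2 V) (o a₁ a₂ v b : V) : R :=
  2 * prob pa (avoidAll ends a₂ {a₁}) *
      prob pb (avoidAll ends a₂ {a₁} ∩ (connEvent ends a₁ v ∩ (connEvent ends a₂ o ∩ connEvent ends a₂ b))) -
    prob pa (avoidAll ends a₂ {a₁} ∩ connEvent ends a₂ b) *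
      prob pb (avoidAll ends a₂ {a₁} ∩ (connEvent ends a₁ v ∩ connEvent ends a₂ o)) +
    c * prob pa (avoidAll ends a₂ {a₁} ∩ connEvent ends a₂ o) *
      prob pb (avoidAll ends a₂ {a₁} ∩ connEvent ends a₂ b) -
    prob pa (avoidAll ends a₂ {a₁} ∩ connEvent ends a₂ o) *
      prob pb (avoidAll ends a₂ {a₁} ∩ (connEvent ends a₁ v ∩ connEvent ends a₂ b))

/-- `crossA′so` is `crossC` at `c = π`. -/
lemma crossA'so_eq_crossC (p : E → R) (ends : E → Sym2 V) (o a₁ a₂ v b : V) :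
    crossA'so p ends o a₁ a₂ v b =
      crossC p (prob p (connEvent ends a₁ v)) ends o a₁ a₂ v b := by
  unfold crossA'so crossC
  ring

/-- The diagonal pattern is `crossC`. -/
lemma crossC_eq_crossPatC (p : E → R) (c : R) (ends : E → Sym2 V) (o a₁ a₂ v b : V) :
    crossC p c ends o a₁ a₂ v b = crossPatC p p c ends o a₁ a₂ v b := rfl

/-- **The one-edge quadratic of `crossC`** (any edge `e`, weight `q = p e`):
`crossC(p) = (1 − q)²·Φ₀₀ + q(1 − q)·(Φ₀₁ + Φ₁₀) + q²·Φ₁₁` with `Φ_{εη} = crossPatC` on the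
pinned measures `p[e ↦ ε], p[e ↦ η]`. -/
theorem crossC_pin_quadratic (p : E → R) (c : R) (ends : E → Sym2 V) (e : E) (o a₁ a₂ v b : V) :
    crossC p c ends o a₁ a₂ v b =
      (1 - p e) ^ 2 * crossPatC (Function.update p e 0) (Function.update p e 0) c ends o a₁ a₂ v b +
        p e * (1 - p e) *
          (crossPatC (Function.update p e 0) (Function.update p e 1) c ends o a₁ a₂ v b +
            crossPatC (Function.update p e 1) (Function.update p e 0) c ends o a₁ a₂ v b) +
        p e ^ 2 * crossPatC (Function.update p e 1) (Function.update p e 1) c ends o a₁ a₂ v b := by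
  have h : ∀ A : Set (Config E), prob p A =
      p e * prob (Function.update p e 1) A + (1 - p e) * prob (Function.update p e 0) A :=
    fun A => prob_eq_pin p A e
  unfold crossC crossPatC
  rw [h (avoidAll ends a₂ {a₁}),
    h (avoidAll ends a₂ {a₁} ∩ (connEvent ends a₁ v ∩ (connEvent ends a₂ o ∩ connEvent ends a₂ b))),
    h (avoidAll ends a₂ {a₁} ∩ connEvent ends a₂ b),
    h (avoidAll ends a₂ {a₁} ∩ (connEvent ends a₁ v ∩ connEvent ends a₂ o)),
    h (avoidAll ends a₂ {a₁} ∩ connEvent ends a₂ o),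
    h (avoidAll ends a₂ {a₁} ∩ (connEvent ends a₁ v ∩ connEvent ends a₂ b))]
  ring

/-- With the edge `{a₁, a₂}` pinned open every `Q`-mass vanishes, so both mixed patterns are `0`. -/
lemma crossPatC_update_one_eq_zero (p : E → R) (c : R) {e : E} {a₁ a₂ : V}
    (he : ends e = s(a₁, a₂)) (o v b : V) :
    crossPatC (Function.update p e 0) (Function.update p e 1) c ends o a₁ a₂ v b = 0 ∧
      crossPatC (Function.update p e 1) (Function.update p e 0) c ends o a₁ a₂ v b = 0 := by
  have hQ : prob (Function.update p e 1) (avoidAll ends a₂ {a₁}) = 0 := by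
    rw [← Set.inter_univ (avoidAll ends a₂ {a₁})]
    exact prob_Q_inter_update_one p he Set.univ
  unfold crossPatC
  simp only [prob_Q_inter_update_one p he, hQ, mul_zero, zero_mul, sub_zero, add_zero, and_self]

end Defs

section Mono

variable {V : Type*} {E : Type*} [Fintype E] [DecidableEq E] {R : Type*} [Field R]
  [LinearOrder R] [IsStrictOrderedRing R]
variable {ends : E → Sym2 V}

/-- `crossC` is monotone in the constant. -/
lemma crossC_mono {p : E → R} (hp : IsProbVec p) {c c' : R} (hc : c ≤ c') (o a₁ a₂ v b : V) :
    crossC p c ends o a₁ a₂ v b ≤ crossC p c' ends o a₁ a₂ v b := by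
  unfold crossC
  have hx := prob_nonneg hp (avoidAll ends a₂ {a₁} ∩ connEvent ends a₂ o)
  have hy := prob_nonneg hp (avoidAll ends a₂ {a₁} ∩ connEvent ends a₂ b)
  have := mul_nonneg (mul_nonneg (sub_nonneg.2 hc) hx) hy
  nlinarith [this]

/-- The sign of `crossA′so` from the sign of `crossC` at a constant `c ≤ π`. -/
theorem crossA'so_nonneg_of_crossC {p : E → R} (hp : IsProbVec p) {c : R} (o a₁ a₂ v b : V)
    (hc : c ≤ prob p (connEvent ends a₁ v)) (h : 0 ≤ crossC p c ends o a₁ a₂ v b) :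
    0 ≤ crossA'so p ends o a₁ a₂ v b := by
  rw [crossA'so_eq_crossC]
  exact h.trans (crossC_mono hp hc o a₁ a₂ v b)

/-- The quadratic is nonnegative once its three coefficients are. -/
lemma crossC_nonneg_of_coeffs {p : E → R} (hp : IsProbVec p) (c : R) (e : E) (o a₁ a₂ v b : V)
    (h0 : 0 ≤ crossPatC (Function.update p e 0) (Function.update p e 0) c ends o a₁ a₂ v b)
    (h3 : 0 ≤ crossPatC (Function.update p e 1) (Function.update p e 1) c ends o a₁ a₂ v b)
    (h1 : 0 ≤ crossPatC (Function.update p e 0) (Function.update p e 1) c ends o a₁ a₂ v b +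
      crossPatC (Function.update p e 1) (Function.update p e 0) c ends o a₁ a₂ v b) :
    0 ≤ crossC p c ends o a₁ a₂ v b := by
  have hq0 : 0 ≤ p e := hp.nonneg e
  have hq1 : p e ≤ 1 := hp.le_one e
  rw [crossC_pin_quadratic p c ends e o a₁ a₂ v b]
  have k0 := mul_nonneg (sq_nonneg (1 - p e)) h0
  have k1 := mul_nonneg (mul_nonneg hq0 (sub_nonneg.2 hq1)) h1
  have k3 := mul_nonneg (sq_nonneg (p e)) h3
  linarith

end Mono

section Support

variable {V : Type*} {E : Type*} [Fintype E] [DecidableEq E] {R : Type*} [Field R]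
variable {ends : E → Sym2 V}

/-- **The masses of `crossC` only see the support**: `Q`, `oH`, `bH` replaced by events agreeing
with them on `supp p`. -/
theorem crossC_congr_supp (p : E → R) (c : R) (o a₁ a₂ v b : V) {Q' O' B' : Set (Config E)}
    (hQ : avoidAll ends a₂ {a₁} ∩ supp p = Q' ∩ supp p)
    (hO : connEvent ends a₂ o ∩ supp p = O' ∩ supp p)
    (hB : connEvent ends a₂ b ∩ supp p = B' ∩ supp p) :
    crossC p c ends o a₁ a₂ v b =
      2 * prob p Q' * prob p (Q' ∩ (connEvent ends a₁ v ∩ (O' ∩ B'))) -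
        prob p (Q' ∩ B') * prob p (Q' ∩ (connEvent ends a₁ v ∩ O')) +
        c * prob p (Q' ∩ O') * prob p (Q' ∩ B') -
        prob p (Q' ∩ O') * prob p (Q' ∩ (connEvent ends a₁ v ∩ B')) := by
  have hv : connEvent ends a₁ v ∩ supp p = connEvent ends a₁ v ∩ supp p := rfl
  have e1 := prob_congr_supp p hQ
  have e2 := prob_congr_supp p (inter_inter_congr hQ (inter_inter_congr hv
    (inter_inter_congr hO hB)))
  have e3 := prob_congr_supp p (inter_inter_congr hQ hB)
  have e4 := prob_congr_supp p (inter_inter_congr hQ (inter_inter_congr hv hO))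
  have e5 := prob_congr_supp p (inter_inter_congr hQ hO)
  have e6 := prob_congr_supp p (inter_inter_congr hQ (inter_inter_congr hv hB))
  unfold crossC
  rw [e1, e2, e3, e4, e5, e6]

omit [Fintype E] [DecidableEq E] in
/-- On the support, `{a₂ ↮ a₁}` is `{t ↮ a₁}` when `a₂ ↔ t` is sure. -/
lemma avoid_inter_supp_eq_src (p : E → R) {a₂ t : V} (ht : Conn ends (sureConfig p) a₂ t)
    (a₁ : V) : avoidAll ends a₂ {a₁} ∩ supp p = avoidAll ends t {a₁} ∩ supp p := by
  ext ω
  simp only [Set.mem_inter_iff, mem_avoidAll, Finset.mem_singleton, forall_eq]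
  constructor
  · rintro ⟨h1, hω⟩
    exact ⟨fun hc => h1 (conn_trans (conn_of_mem_supp hω ht) hc), hω⟩
  · rintro ⟨h1, hω⟩
    exact ⟨fun hc => h1 (conn_trans (conn_symm (conn_of_mem_supp hω ht)) hc), hω⟩

/-- **Re-rooting `a₂`**: `crossC` with `a₂` equals `crossC` with `t` when `a₂ ↔ t` is sure. -/
theorem crossC_reroot (p : E → R) (c : R) {a₂ t : V} (ht : Conn ends (sureConfig p) a₂ t)
    (o a₁ v b : V) : crossC p c ends o a₁ a₂ v b = crossC p c ends o a₁ t v b :=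
  crossC_congr_supp p c o a₁ a₂ v b (avoid_inter_supp_eq_src p ht a₁)
    (connEvent_inter_supp_eq (R := R) p ht o) (connEvent_inter_supp_eq (R := R) p ht b)

omit [Fintype E] [DecidableEq E] in
/-- Sure connections give equal clusters. -/
lemma cluster_eq_of_conn {ω : Config E} {a₂ t : V} (ht : Conn ends ω a₂ t) :
    cluster ends ω t = cluster ends ω a₂ := by
  ext u
  simp only [cluster, Set.mem_setOf_eq]
  exact ⟨fun h => conn_trans ht h, fun h => conn_trans (conn_symm ht) h⟩

end Support

section Base

variable {V : Type*} {E : Type*} [Fintype E] [DecidableEq E] {R : Type*} [Field R]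
  [LinearOrder R] [IsStrictOrderedRing R]
variable {ends : E → Sym2 V}

omit [Fintype E] [DecidableEq E] [LinearOrder R] [IsStrictOrderedRing R] in
/-- On the support, `Q = ∅` when `a₁ ∈ S = C_{sure}(a₂)` and every edge at `S` is deterministic. -/
lemma avoid_inter_supp_of_mem_a2 {p : E → R} {a₂ : V}
    (hdet : ∀ e ∈ touches ends (cluster ends (sureConfig p) a₂), p e = 0 ∨ p e = 1) {a₁ : V}
    (ha : a₁ ∈ cluster ends (sureConfig p) a₂) :
    avoidAll ends a₂ {a₁} ∩ supp p = (∅ : Set (Config E)) ∩ supp p := by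
  rw [Set.empty_inter]
  ext ω
  simp only [Set.mem_inter_iff, mem_avoidAll, Finset.mem_singleton, forall_eq,
    Set.mem_empty_iff_false, iff_false, not_and]
  intro h1 hω
  apply h1
  have : a₁ ∈ cluster ends ω a₂ := by
    rw [cluster_eq_of_det hdet hω]
    exact ha
  exact this

omit [Fintype E] [DecidableEq E] [LinearOrder R] [IsStrictOrderedRing R] in
/-- On the support, `Q` is everything when `a₁ ∉ S`. -/
lemma avoid_inter_supp_of_not_mem_a2 {p : E → R} {a₂ : V}
    (hdet : ∀ e ∈ touches ends (cluster ends (sureConfig p) a₂), p e = 0 ∨ p e = 1) {a₁ : V}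
    (ha : a₁ ∉ cluster ends (sureConfig p) a₂) :
    avoidAll ends a₂ {a₁} ∩ supp p = (Set.univ : Set (Config E)) ∩ supp p := by
  rw [Set.univ_inter]
  ext ω
  simp only [Set.mem_inter_iff, mem_avoidAll, Finset.mem_singleton, forall_eq]
  constructor
  · exact fun h => h.2
  · intro hω
    refine ⟨fun hc => ha ?_, hω⟩
    rw [← cluster_eq_of_det hdet hω]
    exact hc

/-- **The base case**: if every edge at the sure cluster `S` of `a₂` is deterministic, then
`K = S` surely and `crossC = c·[a₁ ∉ S]·[o ∈ S]·[b ∈ S] ≥ 0`. -/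
theorem crossC_nonneg_of_det {p : E → R} {c : R} (hc : 0 ≤ c) {a₂ : V}
    (hdet : ∀ e ∈ touches ends (cluster ends (sureConfig p) a₂), p e = 0 ∨ p e = 1)
    (o a₁ v b : V) : 0 ≤ crossC p c ends o a₁ a₂ v b := by
  by_cases ha : a₁ ∈ cluster ends (sureConfig p) a₂
  · rw [crossC_congr_supp p c o a₁ a₂ v b (avoid_inter_supp_of_mem_a2 hdet ha) rfl rfl]
    simp
  · by_cases ho : o ∈ cluster ends (sureConfig p) a₂
    · by_cases hb : b ∈ cluster ends (sureConfig p) a₂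
      · rw [crossC_congr_supp p c o a₁ a₂ v b (avoid_inter_supp_of_not_mem_a2 hdet ha)
          (connEvent_inter_supp_of_mem hdet ho) (connEvent_inter_supp_of_mem hdet hb)]
        simp only [Set.univ_inter, Set.inter_univ, prob_univ]
        linarith
      · rw [crossC_congr_supp p c o a₁ a₂ v b (avoid_inter_supp_of_not_mem_a2 hdet ha)
          (connEvent_inter_supp_of_mem hdet ho) (connEvent_inter_supp_of_not_mem hdet hb)]
        simp
    · rw [crossC_congr_supp p c o a₁ a₂ v b (avoid_inter_supp_of_not_mem_a2 hdet ha)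
        (connEvent_inter_supp_of_not_mem hdet ho) rfl]
      simp

end Base

section Loop

variable {V : Type*} {E : Type*} [Fintype E] [DecidableEq E] {R : Type*} [Field R]
  [LinearOrder R] [IsStrictOrderedRing R]
variable {ends : E → Sym2 V}

omit [LinearOrder R] [IsStrictOrderedRing R] in
/-- **A random loop is free** for `crossC`. -/
theorem crossC_update_loop {e : E} {t : V} (hl : ends e = s(t, t)) (p : E → R) (c : R)
    (o a₁ a₂ v b : V) :
    crossC (Function.update p e 0) c ends o a₁ a₂ v b = crossC p c ends o a₁ a₂ v b := by
  unfold crossC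
  rw [prob_update_zero_loop e p _ (update_loop_mem_iff hl a₂ {a₁}),
    prob_update_zero_loop e p _ (fun ω => by
      simp only [Set.mem_inter_iff, update_loop_mem_iff hl, update_loop_mem_connEvent_iff hl]),
    prob_update_zero_loop e p _ (fun ω => by
      simp only [Set.mem_inter_iff, update_loop_mem_iff hl, update_loop_mem_connEvent_iff hl]),
    prob_update_zero_loop e p _ (fun ω => by
      simp only [Set.mem_inter_iff, update_loop_mem_iff hl, update_loop_mem_connEvent_iff hl]),
    prob_update_zero_loop e p _ (fun ω => by
      simp only [Set.mem_inter_iff, update_loop_mem_iff hl, update_loop_mem_connEvent_iff hl]),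
    prob_update_zero_loop e p _ (fun ω => by
      simp only [Set.mem_inter_iff, update_loop_mem_iff hl, update_loop_mem_connEvent_iff hl])]

end Loop

end CrossAPrimeA2Route

end Summit.Ventures.PercRepro2
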